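import Literature.AlgebraicGeometry.Motives.HodgeDecompositionIsInternalKaehlerProofs
import Literature.NumberTheory.Transcendental.KaehlerHodgeEllipticReductionProofs
import HarnessLib

/-!
# The Hodge decomposition `H^k_dR(M; ℂ) = ⨁_{p+q=k} K^{p,q}` from the elliptic theorems for `Δ_∂̄`

Trunk **T-KAEHLER** (`AlgebraicGeometry/Motives`). Theorems-only sequel of
`HodgeDecompositionIsInternalProofs.lean` / `HodgeDecompositionIsInternalKaehlerProofs.lean`, about the
named fact `Literature.AlgebraicGeometry.Motives.isInternal_hodgePQ` of `HodgeDecomposition.lean`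
(**hodge.S07**, the Hodge decomposition of a compact Kähler manifold: C. Voisin, *Hodge Theory and
Complex Algebraic Geometry I* (2002), §6.1.3, PDF p. 121, "we have an induced decomposition
`Hᵏ(X, ℂ) = ⨁_{p+q=k} H^{p,q}` … called the Hodge decomposition", with Prop. 6.11, whose proof
introduces `K^{p,q}` = "the (de Rham) cohomology classes which are representable by a closed form of
type `(p,q)`" and shows `H^{p,q} = K^{p,q}`, and Cor. 6.14; the tree's `hodgePQ` is `K^{p,q}`).

The sibling files reduce the fact to Warner's Theorem 6.11 for the Hodge–de Rham Laplacian `Δ_d`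
(`isInternal_hodgePQ_of_hodgeTheorem (h11)`, the named fact
`existsUnique_isHarmonicForm_mk_eq_of_compact`, not yet discharged: it is Warner's elliptic
Theorems 6.5/6.6 for `Δ_d`, `HodgeTheoremEllipticReductionProofs.lean`). Voisin's own route to the
harmonic theory of a compact Kähler manifold is through `Δ_∂̄`: Thm. 5.22 (the elliptic theory of
`Δ_∂̄`, "which we will use without proof") ⇒ Thm. 5.24 (`A^{p,q} = ℋ^{p,q} ⊕ Δ_∂̄ A^{p,q}`) and, on a
Kähler manifold, Thm. 6.7 (`Δ_d = 2Δ_∂̄`, proved in the tree: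
`cHodgeLaplacian_eq_two_smul_dolbeaultLaplacian_of_isManifold_complex_of_t2Space`). The tree already
derives Thm. 5.24 (i) on each `A^{p,q}(M)` from Warner's 6.5 (regularity) and 6.6 (compactness) **for
`Δ_∂̄` on `A^{p,q}(M)`**, stated verbatim as hypotheses
(`exists_isDolbeaultHarmonic_add_dolbeaultLaplacian_of_regularity_of_compactness`,
`KaehlerHodgeEllipticReductionProofs.lean`) — and these two analytic statements for `Δ_∂̄` are the
target of the tree's periodic-elliptic programme (`LatticeEllipticEstimate/Regularity`, `ChartOps`,
`ChartDolbeaultOps`, `TorusTransferOps`, …). This file closes the remaining gap on the Kähler side,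
so that `isInternal_hodgePQ` follows from the `Δ_∂̄` theorems alone:

* §1 `exists_add_dolbeaultLaplacian_eq_of_regularity_of_compactness` — on a compact Hermitian
  manifold, 6.5 ∧ 6.6 for `Δ_∂̄` on every `A^{p,q}`, `p + q = k`, give
  `A^k(M; ℂ) = ker Δ_∂̄ + Δ_∂̄ A^k(M; ℂ)`: decompose `α = ∑ α^{p,q}` (Voisin §2.3.1,
  `sum_antidiagonal_typeComponent_holds`), apply Thm. 5.24 (i) to each component and add up
  (`Δ_∂̄` is linear on smooth forms, `CL2SmoothForms.dolbeaultLaplacian`).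
* §2 At a **Kähler** metric `g`: `Δ_d = 2Δ_∂̄` turns §1 into Warner's first line
  `Eᵏ = Δ_d(Eᵏ) + ℋᵏ` for *real* forms (real parts, `re_cHodgeLaplacian`,
  `isCHarmonicForm_iff_re_im`), whence the sum form of Warner's Thm. 6.8
  (`harmonicForms_sup_exactSmoothForms_sup_span_mcoderiv_of_compact_of_dolbeault`, through the tree's
  `harmonicForms_sup_exactSmoothForms_sup_span_mcoderiv_of_hodgeLaplacian`) and Warner's Thm. 6.11 at
  the Kähler metric (`existsUnique_isHarmonicForm_mk_eq_of_compact_of_dolbeault`, through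
  `existsUnique_isHarmonicForm_mk_eq_of_compact_of_hodgeDecompositionSum`) — Voisin's Thm. 5.23 for
  a Kähler metric, obtained from the `Δ_∂̄`-theory.
* §3 `isInternal_hodgePQ_of_dolbeault_regularity_of_compactness (hC) (hR) : isInternal_hodgePQ` —
  **the Hodge decomposition from Warner's 6.6 (`hC`) and 6.5 (`hR`) for `Δ_∂̄` on the `A^{p,q}` of
  compact Kähler manifolds**, the hypotheses being quantified exactly as the instances bound by
  `isInternal_hodgePQ` and stated verbatim in the shape consumed by
  `exists_isDolbeaultHarmonic_add_dolbeaultLaplacian_of_regularity_of_compactness`; assembled as in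
  `isInternal_hodgePQ_of_hodgeTheorem_of_kaehlerIdentity` (Kähler metric from
  `IsKaehlerManifold.exists_isKaehler`, complex orientation, `isInternal_hodgePQ_of_harmonicTheory`).

No named fact is introduced (D-0026); the closed discharge `isInternal_hodgePQ_holds` is this
theorem fed the two `Δ_∂̄` theorems, or `isInternal_hodgePQ_of_hodgeTheorem` fed
`existsUnique_isHarmonicForm_mk_eq_of_compact_holds`, whichever lands first.

## References

* C. Voisin, *Hodge Theory and Complex Algebraic Geometry I*, Cambridge Studies in Advanced
  Mathematics 76 (2002), §2.3.1, §5.2.3 Thm. 5.22, §5.3.1 Thm. 5.23, Thm. 5.24, §6.1.2 Thm. 6.7,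
  Cor. 6.10, §6.1.3 (PDF p. 121) Prop. 6.11, Cor. 6.14. [Voisin2002]
* F. W. Warner, *Foundations of Differentiable Manifolds and Lie Groups*, GTM 94 (1983), Thms. 6.5,
  6.6, 6.8, 6.11 (pp. 222–225). [WarnerGTM94]
-/

noncomputable section

open scoped Manifold ContDiff Topology ComplexInnerProductSpace
open Bundle Module Set Finset

namespace Literature.AlgebraicGeometry.Motives

open Literature.Geometry.Kaehler Literature.NumberTheory.Transcendental

/-! ### §1 `A^k(M; ℂ) = ker Δ_∂̄ + Δ_∂̄ A^k(M; ℂ)` from 6.5 and 6.6 for `Δ_∂̄` on the `A^{p,q}` -/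

section Hermitian

variable {E : Type*} [NormedAddCommGroup E] [NormedSpace ℂ E] [FiniteDimensional ℂ E]
  {n : ℕ} [Fact (finrank ℝ E = n)]
  {M : Type*} [TopologicalSpace M] [ChartedSpace E M]
  [IsManifold 𝓘(ℂ, E) ω M] [IsManifold 𝓘(ℝ, E) ∞ M]
  [RiemannianBundle (fun x : M ↦ TangentSpace 𝓘(ℝ, E) x)]
  [IsContMDiffRiemannianBundle 𝓘(ℝ, E) ∞ E (fun x : M ↦ TangentSpace 𝓘(ℝ, E) x)]
  (o : (x : M) → Orientation ℝ (TangentSpace 𝓘(ℝ, E) x) (Fin n))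
  [MeasurableSpace E] [BorelSpace E] [T2Space M] [CompactSpace M]
  [IsContinuousRiemannianBundle E (fun x : M ↦ TangentSpace 𝓘(ℝ, E) x)]
  [Fact (IsSmoothForm (riemannianVolumeForm o))]

/-- **`A^k(M; ℂ) = ker Δ_∂̄ + Δ_∂̄(A^k(M; ℂ))` on a compact Hermitian manifold, from Warner's Theorems
6.6 (`hC`, compactness) and 6.5 (`hR`, regularity) for `Δ_∂̄` on each `A^{p,q}(M)`, `p + q = k`**
(Voisin (2002), Thm. 5.24 (i) summed over the types: every smooth complex `k`-form is
`α = ∑_{p+q=k} α^{p,q}` (§2.3.1) and each `α^{p,q} = η^{p,q} + Δ_∂̄ w^{p,q}` with `η^{p,q}`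
`∂̄`-harmonic, `exists_isDolbeaultHarmonic_add_dolbeaultLaplacian_of_regularity_of_compactness`).
Setting: compact complex manifold (holomorphic atlas), `C^∞` metric Hermitian in the instance form
`hJ`, orientation family `o` with smooth volume form (`Fact`), `k + m = dim_ℝ M`. Conclusion: every
smooth complex `k`-form is `η + Δ_∂̄ w` with `η`, `w` smooth and `Δ_∂̄ η = 0`.
[cite: Voisin2002, Thm. 5.24 (i)] -/
theorem exists_add_dolbeaultLaplacian_eq_of_regularity_of_compactness
    (hJ : ∀ (x : M) (v w : TangentSpace 𝓘(ℝ, E) x),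
      inner ℝ (tangentJ E x v) (tangentJ E x w) = inner ℝ v w)
    {k m : ℕ} (h : k + m = n)
    (hC : ∀ (p q : ℕ) (h' : (p + q) + m = n) (u : ℕ → CL2SmoothForms.pq o p q) (c : ℝ),
      (∀ i, ‖u i‖ ≤ c) → (∀ i, ‖CL2SmoothForms.pqLaplacian o hJ p q h' (u i)‖ ≤ c) →
        ∃ φ : ℕ → ℕ, StrictMono φ ∧ CauchySeq (u ∘ φ))
    (hR : ∀ (p q : ℕ) (h' : (p + q) + m = n) (α : CL2SmoothForms.pq o p q)
      (ℓ : CL2SmoothForms.pq o p q →L[ℂ] ℂ),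
      (∀ φ, ℓ (CL2SmoothForms.pqLaplacian o hJ p q h' φ) = ⟪α, φ⟫) →
        ∃ w : CL2SmoothForms.pq o p q, ∀ φ, ℓ φ = ⟪w, φ⟫)
    {α : MForm 𝓘(ℝ, E) M ℂ k} (hα : IsSmoothForm α) :
    ∃ η w : MForm 𝓘(ℝ, E) M ℂ k, IsSmoothForm η ∧ dolbeaultLaplacian o k m h η = 0 ∧
      IsSmoothForm w ∧ α = η + dolbeaultLaplacian o k m h w := by
  -- Thm. 5.24 (i) on each `A^{p,q}`, `p + q = k`, read in degree `k`
  have step : ∀ pq : ↥(antidiagonal k), ∃ η w : MForm 𝓘(ℝ, E) M ℂ k,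
      IsSmoothForm η ∧ dolbeaultLaplacian o k m h η = 0 ∧ IsSmoothForm w ∧
        α.typeComponent pq.1.1 pq.1.2 = η + dolbeaultLaplacian o k m h w := by
    rintro ⟨⟨p, q⟩, hpq⟩
    have hpq' : p + q = k := mem_antidiagonal.1 hpq
    subst hpq'
    obtain ⟨η, w, hη, hw, -, hdec⟩ :=
      exists_isDolbeaultHarmonic_add_dolbeaultLaplacian_of_regularity_of_compactness o hJ h
        (hC p q h) (hR p q h) (hα.typeComponent p q) (isOfType_typeComponent_holds rfl α)
    exact ⟨η, w, hη.1, hη.2.2, hw, hdec⟩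
  choose η w hη hΔη hw hdec using step
  -- add up inside `A^k(M; ℂ)`, where `Δ_∂̄` is a linear operator
  let H : ↥(antidiagonal k) → CL2SmoothForms o k := fun pq ↦ CL2SmoothForms.mk o (η pq) (hη pq)
  let W : ↥(antidiagonal k) → CL2SmoothForms o k := fun pq ↦ CL2SmoothForms.mk o (w pq) (hw pq)
  have hHsum : CL2SmoothForms.toForm o (∑ pq, H pq) = ∑ pq, η pq := by
    rw [← CL2SmoothForms.toFormₗ_apply, map_sum]
    exact Finset.sum_congr rfl fun pq _ ↦ rfl
  have hWsum : CL2SmoothForms.toForm o (∑ pq, W pq) = ∑ pq, w pq := by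
    rw [← CL2SmoothForms.toFormₗ_apply, map_sum]
    exact Finset.sum_congr rfl fun pq _ ↦ rfl
  have hΔH : dolbeaultLaplacian o k m h (CL2SmoothForms.toForm o (∑ pq, H pq)) = 0 := by
    rw [← CL2SmoothForms.toForm_dolbeaultLaplacian, map_sum, ← CL2SmoothForms.toFormₗ_apply, map_sum]
    refine Finset.sum_eq_zero fun pq _ ↦ ?_
    rw [CL2SmoothForms.toFormₗ_apply, CL2SmoothForms.toForm_dolbeaultLaplacian]
    exact hΔη pq
  have hΔW : dolbeaultLaplacian o k m h (CL2SmoothForms.toForm o (∑ pq, W pq)) =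
      ∑ pq, dolbeaultLaplacian o k m h (w pq) := by
    rw [← CL2SmoothForms.toForm_dolbeaultLaplacian, map_sum, ← CL2SmoothForms.toFormₗ_apply, map_sum]
    exact Finset.sum_congr rfl fun pq _ ↦ rfl
  refine ⟨CL2SmoothForms.toForm o (∑ pq, H pq), CL2SmoothForms.toForm o (∑ pq, W pq),
    CL2SmoothForms.isSmoothForm_toForm o _, hΔH, CL2SmoothForms.isSmoothForm_toForm o _, ?_⟩
  rw [hΔW, hHsum, ← Finset.sum_add_distrib]
  calc α = ∑ pq ∈ antidiagonal k, α.typeComponent pq.1 pq.2 :=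
        (sum_antidiagonal_typeComponent_holds α).symm
    _ = ∑ pq : ↥(antidiagonal k), α.typeComponent pq.1.1 pq.1.2 :=
        (Finset.sum_coe_sort (antidiagonal k) (fun pq ↦ α.typeComponent pq.1 pq.2)).symm
    _ = ∑ pq : ↥(antidiagonal k), (η pq + dolbeaultLaplacian o k m h (w pq)) :=
        Finset.sum_congr rfl fun pq _ ↦ hdec pq

end Hermitian

/-! ### §2 Warner's 6.8 (sum form) and 6.11 at a Kähler metric, from the `Δ_∂̄` theorems -/

section Kaehler

variable {E : Type*} [NormedAddCommGroup E] [NormedSpace ℂ E] [FiniteDimensional ℂ E]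
  {n : ℕ} [Fact (finrank ℝ E = n)]
  {M : Type*} [TopologicalSpace M] [ChartedSpace E M]
  [IsManifold 𝓘(ℂ, E) ω M] [IsManifold 𝓘(ℝ, E) ∞ M] [T2Space M] [CompactSpace M]
  (g : ContMDiffRiemannianMetric 𝓘(ℝ, E) ∞ E (fun x : M ↦ TangentSpace 𝓘(ℝ, E) x))
  (o : (x : M) → Orientation ℝ (TangentSpace 𝓘(ℝ, E) x) (Fin n))

/-- **Warner's Theorem 6.8, sum form `Eᵏ⁺¹ = ℋᵏ⁺¹ + dEᵏ + δEᵏ⁺²`, at a Kähler metric, from Warner's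
6.6/6.5 for `Δ_∂̄`** (the named fact
`harmonicForms_sup_exactSmoothForms_sup_span_mcoderiv_of_compact 𝓘(ℝ, E) M o k m` of
`HodgeTheorem.lean` for the metric of `g`). Setting: compact Kähler `(M, g)` (holomorphic atlas,
`hg`), `g` installed as the Riemannian bundle structure, orientation family `o`. Hypotheses: `hC`,
`hR` — Warner's compactness and regularity theorems for `Δ_∂̄` on `A^{p,q}(M)` for every type and
degree witness (for every Borel structure on `E` and given that `vol_o` is smooth), verbatim as in
`exists_isDolbeaultHarmonic_add_dolbeaultLaplacian_of_regularity_of_compactness`. Proof: for a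
smooth real form `β`, §1 gives `β ⊗ 1 = η + Δ_∂̄ w` with `Δ_∂̄ η = 0`; by `Δ_d = 2Δ_∂̄` (Voisin,
Thm. 6.7) `η` is `Δ_d`-harmonic and `Δ_∂̄ w = Δ_d (w/2)`, so `β = Re η + Δ_d Re (w/2)` with `Re η`
harmonic (`re_cHodgeLaplacian`, `isCHarmonicForm_iff_re_im`) — Warner's first line
`E = Δ(E) + ℋ`, fed to `harmonicForms_sup_exactSmoothForms_sup_span_mcoderiv_of_hodgeLaplacian`.
[cite: WarnerGTM94, Thm. 6.8] -/
theorem harmonicForms_sup_exactSmoothForms_sup_span_mcoderiv_of_compact_of_dolbeault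
    (hg : g.toRiemannianMetric.IsKaehler)
    (hC : ∀ [MeasurableSpace E] [BorelSpace E]
      (hJ : letI : RiemannianBundle (fun x : M ↦ TangentSpace 𝓘(ℝ, E) x) := ⟨g.toRiemannianMetric⟩
        ∀ (x : M) (v w : TangentSpace 𝓘(ℝ, E) x),
          inner ℝ (tangentJ E x v) (tangentJ E x w) = inner ℝ v w)
      (p q : ℕ) {m : ℕ} (h : (p + q) + m = n)
      (ho : letI : RiemannianBundle (fun x : M ↦ TangentSpace 𝓘(ℝ, E) x) := ⟨g.toRiemannianMetric⟩
        IsSmoothForm (riemannianVolumeForm o)),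
      letI : RiemannianBundle (fun x : M ↦ TangentSpace 𝓘(ℝ, E) x) := ⟨g.toRiemannianMetric⟩
      haveI : IsContMDiffRiemannianBundle 𝓘(ℝ, E) ∞ E (fun x : M ↦ TangentSpace 𝓘(ℝ, E) x) :=
        ⟨g.inner, g.contMDiff, fun _ _ _ ↦ rfl⟩
      haveI : Fact (IsSmoothForm (riemannianVolumeForm o)) := ⟨ho⟩
      ∀ (u : ℕ → CL2SmoothForms.pq o p q) (c : ℝ), (∀ i, ‖u i‖ ≤ c) →
        (∀ i, ‖CL2SmoothForms.pqLaplacian o hJ p q h (u i)‖ ≤ c) →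
          ∃ φ : ℕ → ℕ, StrictMono φ ∧ CauchySeq (u ∘ φ))
    (hR : ∀ [MeasurableSpace E] [BorelSpace E]
      (hJ : letI : RiemannianBundle (fun x : M ↦ TangentSpace 𝓘(ℝ, E) x) := ⟨g.toRiemannianMetric⟩
        ∀ (x : M) (v w : TangentSpace 𝓘(ℝ, E) x),
          inner ℝ (tangentJ E x v) (tangentJ E x w) = inner ℝ v w)
      (p q : ℕ) {m : ℕ} (h : (p + q) + m = n)
      (ho : letI : RiemannianBundle (fun x : M ↦ TangentSpace 𝓘(ℝ, E) x) := ⟨g.toRiemannianMetric⟩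
        IsSmoothForm (riemannianVolumeForm o)),
      letI : RiemannianBundle (fun x : M ↦ TangentSpace 𝓘(ℝ, E) x) := ⟨g.toRiemannianMetric⟩
      haveI : IsContMDiffRiemannianBundle 𝓘(ℝ, E) ∞ E (fun x : M ↦ TangentSpace 𝓘(ℝ, E) x) :=
        ⟨g.inner, g.contMDiff, fun _ _ _ ↦ rfl⟩
      haveI : Fact (IsSmoothForm (riemannianVolumeForm o)) := ⟨ho⟩
      ∀ (α : CL2SmoothForms.pq o p q) (ℓ : CL2SmoothForms.pq o p q →L[ℂ] ℂ),
        (∀ φ, ℓ (CL2SmoothForms.pqLaplacian o hJ p q h φ) = ⟪α, φ⟫) →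
          ∃ w : CL2SmoothForms.pq o p q, ∀ φ, ℓ φ = ⟪w, φ⟫)
    (k m : ℕ) :
    letI : RiemannianBundle (fun x : M ↦ TangentSpace 𝓘(ℝ, E) x) := ⟨g.toRiemannianMetric⟩
    haveI : IsContMDiffRiemannianBundle 𝓘(ℝ, E) ∞ E (fun x : M ↦ TangentSpace 𝓘(ℝ, E) x) :=
      ⟨g.inner, g.contMDiff, fun _ _ _ ↦ rfl⟩
    harmonicForms_sup_exactSmoothForms_sup_span_mcoderiv_of_compact 𝓘(ℝ, E) M o k m := by
  letI : RiemannianBundle (fun x : M ↦ TangentSpace 𝓘(ℝ, E) x) := ⟨g.toRiemannianMetric⟩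
  haveI : IsContMDiffRiemannianBundle 𝓘(ℝ, E) ∞ E (fun x : M ↦ TangentSpace 𝓘(ℝ, E) x) :=
    ⟨g.inner, g.contMDiff, fun _ _ _ ↦ rfl⟩
  haveI : IsContinuousRiemannianBundle E (fun x : M ↦ TangentSpace 𝓘(ℝ, E) x) :=
    ⟨g.inner, g.contMDiff.continuous, fun _ _ _ ↦ rfl⟩
  refine (harmonicForms_sup_exactSmoothForms_sup_span_mcoderiv_of_compact_iff 𝓘(ℝ, E) M o k m).2
    (harmonicForms_sup_exactSmoothForms_sup_span_mcoderiv_of_hodgeLaplacian 𝓘(ℝ, E) o ?_)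
  intro ho h β hβ
  letI : MeasurableSpace E := borel E
  haveI : BorelSpace E := ⟨rfl⟩
  haveI : Fact (IsSmoothForm (riemannianVolumeForm o)) := ⟨ho⟩
  have hJ : ∀ (x : M) (v w : TangentSpace 𝓘(ℝ, E) x),
      inner ℝ (tangentJ E x v) (tangentJ E x w) = inner ℝ v w := fun x v w ↦ hg.isHermitian x v w
  have hK : cHodgeLaplacian_eq_two_smul_dolbeaultLaplacian_of_isManifold_complex
      (k := k + 1) (m := m + 1) g o :=
    cHodgeLaplacian_eq_two_smul_dolbeaultLaplacian_of_isManifold_complex_of_t2Space g o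
  -- §1: `β ⊗ 1 = η + Δ_∂̄ w`, `Δ_∂̄ η = 0`
  obtain ⟨η, w, hη, hΔη, hw, hdec⟩ :=
    exists_add_dolbeaultLaplacian_eq_of_regularity_of_compactness o hJ h
      (fun p q h' ↦ hC hJ p q h' ho) (fun p q h' ↦ hR hJ p q h' ho) hβ.ofReal
  -- `Δ_d = 2Δ_∂̄`: `η` is `Δ_d`-harmonic and `Δ_∂̄ w = Δ_d (w / 2)`
  have hφ : IsSmoothForm ((2⁻¹ : ℂ) • w) := IsSmoothForm.smul_complex _ hw
  have hΔφ : cHodgeLaplacian o (k + 1) (m + 1) h ((2⁻¹ : ℂ) • w) =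
      dolbeaultLaplacian o (k + 1) (m + 1) h w := by
    rw [hK hg h hφ ho, dolbeaultLaplacian_smul o h, smul_smul,
      mul_inv_cancel₀ (two_ne_zero : (2 : ℂ) ≠ 0), one_smul]
  have hηh : IsCHarmonicForm o h η := ⟨hη, by rw [hK hg h hη ho, hΔη, smul_zero]⟩
  refine ⟨((2⁻¹ : ℂ) • w).re, hφ.re, ?_⟩
  -- real parts: `β - Δ_d Re (w/2) = Re η`, harmonic
  have hre : β - hodgeLaplacian o (k + 1) (m + 1) h ((2⁻¹ : ℂ) • w).re = η.re := by
    have hβre := congrArg MForm.re hdec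
    rw [MForm.re_ofReal, MForm.re_add] at hβre
    rw [← re_cHodgeLaplacian o ho h hφ, hΔφ, hβre, add_sub_cancel_right]
  rw [hre]
  exact subset_harmonicForms o h ((isCHarmonicForm_iff_re_im o ho h η).1 hηh).1

/-- **Warner's Theorem 6.11 at a Kähler metric from Warner's 6.6/6.5 for `Δ_∂̄`** (Voisin (2002),
Thm. 5.23 for a Kähler metric, by her route Thm. 5.22 ⇒ Thm. 5.24 ⇒ (Thm. 6.7) harmonic theory of
`Δ_d`): on a compact Kähler manifold `(M, g)`, given the compactness and regularity theorems for
`Δ_∂̄` on every `A^{p,q}(M)` (`hC`, `hR`, as in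
`harmonicForms_sup_exactSmoothForms_sup_span_mcoderiv_of_compact_of_dolbeault`), every real de Rham
class in every degree has a unique `Δ_d`-harmonic representative for the metric of `g` — the named
fact `existsUnique_isHarmonicForm_mk_eq_of_compact 𝓘(ℝ, E) M o k m` of `HodgeTheorem.lean`
(through `existsUnique_isHarmonicForm_mk_eq_of_compact_of_hodgeDecompositionSum`, Warner's printed
reduction 6.8 ⇒ 6.11). [cite: Voisin2002, Thm. 5.23] -/
theorem existsUnique_isHarmonicForm_mk_eq_of_compact_of_dolbeault
    (hg : g.toRiemannianMetric.IsKaehler)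
    (hC : ∀ [MeasurableSpace E] [BorelSpace E]
      (hJ : letI : RiemannianBundle (fun x : M ↦ TangentSpace 𝓘(ℝ, E) x) := ⟨g.toRiemannianMetric⟩
        ∀ (x : M) (v w : TangentSpace 𝓘(ℝ, E) x),
          inner ℝ (tangentJ E x v) (tangentJ E x w) = inner ℝ v w)
      (p q : ℕ) {m : ℕ} (h : (p + q) + m = n)
      (ho : letI : RiemannianBundle (fun x : M ↦ TangentSpace 𝓘(ℝ, E) x) := ⟨g.toRiemannianMetric⟩
        IsSmoothForm (riemannianVolumeForm o)),
      letI : RiemannianBundle (fun x : M ↦ TangentSpace 𝓘(ℝ, E) x) := ⟨g.toRiemannianMetric⟩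
      haveI : IsContMDiffRiemannianBundle 𝓘(ℝ, E) ∞ E (fun x : M ↦ TangentSpace 𝓘(ℝ, E) x) :=
        ⟨g.inner, g.contMDiff, fun _ _ _ ↦ rfl⟩
      haveI : Fact (IsSmoothForm (riemannianVolumeForm o)) := ⟨ho⟩
      ∀ (u : ℕ → CL2SmoothForms.pq o p q) (c : ℝ), (∀ i, ‖u i‖ ≤ c) →
        (∀ i, ‖CL2SmoothForms.pqLaplacian o hJ p q h (u i)‖ ≤ c) →
          ∃ φ : ℕ → ℕ, StrictMono φ ∧ CauchySeq (u ∘ φ))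
    (hR : ∀ [MeasurableSpace E] [BorelSpace E]
      (hJ : letI : RiemannianBundle (fun x : M ↦ TangentSpace 𝓘(ℝ, E) x) := ⟨g.toRiemannianMetric⟩
        ∀ (x : M) (v w : TangentSpace 𝓘(ℝ, E) x),
          inner ℝ (tangentJ E x v) (tangentJ E x w) = inner ℝ v w)
      (p q : ℕ) {m : ℕ} (h : (p + q) + m = n)
      (ho : letI : RiemannianBundle (fun x : M ↦ TangentSpace 𝓘(ℝ, E) x) := ⟨g.toRiemannianMetric⟩
        IsSmoothForm (riemannianVolumeForm o)),
      letI : RiemannianBundle (fun x : M ↦ TangentSpace 𝓘(ℝ, E) x) := ⟨g.toRiemannianMetric⟩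
      haveI : IsContMDiffRiemannianBundle 𝓘(ℝ, E) ∞ E (fun x : M ↦ TangentSpace 𝓘(ℝ, E) x) :=
        ⟨g.inner, g.contMDiff, fun _ _ _ ↦ rfl⟩
      haveI : Fact (IsSmoothForm (riemannianVolumeForm o)) := ⟨ho⟩
      ∀ (α : CL2SmoothForms.pq o p q) (ℓ : CL2SmoothForms.pq o p q →L[ℂ] ℂ),
        (∀ φ, ℓ (CL2SmoothForms.pqLaplacian o hJ p q h φ) = ⟪α, φ⟫) →
          ∃ w : CL2SmoothForms.pq o p q, ∀ φ, ℓ φ = ⟪w, φ⟫)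
    (k m : ℕ) :
    letI : RiemannianBundle (fun x : M ↦ TangentSpace 𝓘(ℝ, E) x) := ⟨g.toRiemannianMetric⟩
    haveI : IsContMDiffRiemannianBundle 𝓘(ℝ, E) ∞ E (fun x : M ↦ TangentSpace 𝓘(ℝ, E) x) :=
      ⟨g.inner, g.contMDiff, fun _ _ _ ↦ rfl⟩
    existsUnique_isHarmonicForm_mk_eq_of_compact 𝓘(ℝ, E) M o k m := by
  letI : RiemannianBundle (fun x : M ↦ TangentSpace 𝓘(ℝ, E) x) := ⟨g.toRiemannianMetric⟩
  haveI : IsContMDiffRiemannianBundle 𝓘(ℝ, E) ∞ E (fun x : M ↦ TangentSpace 𝓘(ℝ, E) x) :=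
    ⟨g.inner, g.contMDiff, fun _ _ _ ↦ rfl⟩
  exact existsUnique_isHarmonicForm_mk_eq_of_compact_of_hodgeDecompositionSum 𝓘(ℝ, E) M o k m
    fun k' m' ↦ harmonicForms_sup_exactSmoothForms_sup_span_mcoderiv_of_compact_of_dolbeault g o hg
      hC hR k' m'

end Kaehler

/-! ### §3 Assembly: `isInternal_hodgePQ` from Warner's 6.5 and 6.6 for `Δ_∂̄` -/

section Assembly

variable {E : Type*} [NormedAddCommGroup E] [NormedSpace ℂ E]
  {M : Type*} [TopologicalSpace M] [ChartedSpace E M] [FiniteDimensional ℂ E]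
  [IsManifold 𝓘(ℝ, E) ∞ M]

/-- **hodge.S07, the Hodge decomposition `H^k_dR(M; ℂ) = ⨁_{p+q=k} K^{p,q}`, from the elliptic
theorems for `Δ_∂̄`** (Voisin (2002), §6.1.3, p. 121 with Prop. 6.11 and Cor. 6.14; her printed
route Thm. 5.22 ⇒ Thm. 5.24 ⇒ Thm. 5.23/Cor. 6.10 via Thm. 6.7). The named fact `isInternal_hodgePQ`
follows from Warner's Theorem 6.6 (`hC`: a sequence in `A^{p,q}(M)` bounded together with its
`Δ_∂̄` has an `L²`-Cauchy subsequence) and Theorem 6.5 (`hR`: every weak solution `ℓ` of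
`Δ_∂̄ ω = α` on `A^{p,q}(M)` is `⟪ω, ·⟫` for a smooth `ω ∈ A^{p,q}`) **for `Δ_∂̄` restricted to the
smooth `(p,q)`-forms of `M`**, for every smooth metric `g` Hermitian in the instance form `hJ`,
every orientation family `o` with smooth volume form, every Borel structure on `E`, all types
`(p,q)` and degree witnesses — quantified over the instances that `isInternal_hodgePQ` binds and
stated verbatim in the shape of
`exists_isDolbeaultHarmonic_add_dolbeaultLaplacian_of_regularity_of_compactness`
(`KaehlerHodgeEllipticReductionProofs.lean`). Given a Kähler metric
(`IsKaehlerManifold.exists_isKaehler`), the complex orientation `x ↦ o₀` has smooth volume form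
(`isSmoothForm_riemannianVolumeForm_of_isContinuousOrientation_holds`), Warner's 6.11 holds at `g` by
`existsUnique_isHarmonicForm_mk_eq_of_compact_of_dolbeault`, the Kähler identity by
`cHodgeLaplacian_eq_two_smul_dolbeaultLaplacian_of_isManifold_complex_of_t2Space`, and
`isInternal_hodgePQ_of_harmonicTheory` applies in degrees `k ≤ dim_ℝ M`; above,
`isInternal_hodgePQ_of_finrank_lt`. No named fact is introduced (D-0026).
[cite: Voisin2002, §6.1.3 Prop. 6.11] -/
theorem isInternal_hodgePQ_of_dolbeault_regularity_of_compactness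
    (hC : ∀ [IsManifold 𝓘(ℂ, E) ω M] [T2Space M] [CompactSpace M] [MeasurableSpace E] [BorelSpace E]
      {n : ℕ} [Fact (finrank ℝ E = n)]
      (g : ContMDiffRiemannianMetric 𝓘(ℝ, E) ∞ E (fun x : M ↦ TangentSpace 𝓘(ℝ, E) x))
      (hJ : letI : RiemannianBundle (fun x : M ↦ TangentSpace 𝓘(ℝ, E) x) := ⟨g.toRiemannianMetric⟩
        ∀ (x : M) (v w : TangentSpace 𝓘(ℝ, E) x),
          inner ℝ (tangentJ E x v) (tangentJ E x w) = inner ℝ v w)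
      (o : (x : M) → Orientation ℝ (TangentSpace 𝓘(ℝ, E) x) (Fin n))
      (p q : ℕ) {m : ℕ} (h : (p + q) + m = n)
      (ho : letI : RiemannianBundle (fun x : M ↦ TangentSpace 𝓘(ℝ, E) x) := ⟨g.toRiemannianMetric⟩
        IsSmoothForm (riemannianVolumeForm o)),
      letI : RiemannianBundle (fun x : M ↦ TangentSpace 𝓘(ℝ, E) x) := ⟨g.toRiemannianMetric⟩
      haveI : IsContMDiffRiemannianBundle 𝓘(ℝ, E) ∞ E (fun x : M ↦ TangentSpace 𝓘(ℝ, E) x) :=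
        ⟨g.inner, g.contMDiff, fun _ _ _ ↦ rfl⟩
      haveI : Fact (IsSmoothForm (riemannianVolumeForm o)) := ⟨ho⟩
      ∀ (u : ℕ → CL2SmoothForms.pq o p q) (c : ℝ), (∀ i, ‖u i‖ ≤ c) →
        (∀ i, ‖CL2SmoothForms.pqLaplacian o hJ p q h (u i)‖ ≤ c) →
          ∃ φ : ℕ → ℕ, StrictMono φ ∧ CauchySeq (u ∘ φ))
    (hR : ∀ [IsManifold 𝓘(ℂ, E) ω M] [T2Space M] [CompactSpace M] [MeasurableSpace E] [BorelSpace E]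
      {n : ℕ} [Fact (finrank ℝ E = n)]
      (g : ContMDiffRiemannianMetric 𝓘(ℝ, E) ∞ E (fun x : M ↦ TangentSpace 𝓘(ℝ, E) x))
      (hJ : letI : RiemannianBundle (fun x : M ↦ TangentSpace 𝓘(ℝ, E) x) := ⟨g.toRiemannianMetric⟩
        ∀ (x : M) (v w : TangentSpace 𝓘(ℝ, E) x),
          inner ℝ (tangentJ E x v) (tangentJ E x w) = inner ℝ v w)
      (o : (x : M) → Orientation ℝ (TangentSpace 𝓘(ℝ, E) x) (Fin n))
      (p q : ℕ) {m : ℕ} (h : (p + q) + m = n)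
      (ho : letI : RiemannianBundle (fun x : M ↦ TangentSpace 𝓘(ℝ, E) x) := ⟨g.toRiemannianMetric⟩
        IsSmoothForm (riemannianVolumeForm o)),
      letI : RiemannianBundle (fun x : M ↦ TangentSpace 𝓘(ℝ, E) x) := ⟨g.toRiemannianMetric⟩
      haveI : IsContMDiffRiemannianBundle 𝓘(ℝ, E) ∞ E (fun x : M ↦ TangentSpace 𝓘(ℝ, E) x) :=
        ⟨g.inner, g.contMDiff, fun _ _ _ ↦ rfl⟩
      haveI : Fact (IsSmoothForm (riemannianVolumeForm o)) := ⟨ho⟩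
      ∀ (α : CL2SmoothForms.pq o p q) (ℓ : CL2SmoothForms.pq o p q →L[ℂ] ℂ),
        (∀ φ, ℓ (CL2SmoothForms.pqLaplacian o hJ p q h φ) = ⟪α, φ⟫) →
          ∃ w : CL2SmoothForms.pq o p q, ∀ φ, ℓ φ = ⟪w, φ⟫) :
    isInternal_hodgePQ (E := E) (M := M) := by
  intro _ _ _ _ k
  by_cases hk : finrank ℝ E < k
  · exact isInternal_hodgePQ_of_finrank_lt hk
  obtain ⟨m, hm⟩ : ∃ m, k + m = finrank ℝ E := ⟨finrank ℝ E - k, by omega⟩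
  obtain ⟨g, hg⟩ := IsKaehlerManifold.exists_isKaehler (E := E) (M := M)
  haveI : Fact (finrank ℝ E = finrank ℝ E) := ⟨rfl⟩
  let o : (x : M) → Orientation ℝ (TangentSpace 𝓘(ℝ, E) x) (Fin (finrank ℝ E)) :=
    fun _ ↦ (modelBasis E (finrank ℝ E)).orientation
  have ho : letI : RiemannianBundle (fun x : M ↦ TangentSpace 𝓘(ℝ, E) x) := ⟨g.toRiemannianMetric⟩
      IsSmoothForm (riemannianVolumeForm o) := by
    letI : RiemannianBundle (fun x : M ↦ TangentSpace 𝓘(ℝ, E) x) := ⟨g.toRiemannianMetric⟩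
    haveI : IsContinuousRiemannianBundle E (fun x : M ↦ TangentSpace 𝓘(ℝ, E) x) :=
      ⟨g.inner, g.contMDiff.continuous, fun _ _ _ ↦ rfl⟩
    exact isSmoothForm_riemannianVolumeForm_of_isContinuousOrientation_holds o
      (isContinuousOrientation_const _)
  refine isInternal_hodgePQ_of_harmonicTheory g o
    (cHodgeLaplacian_eq_two_smul_dolbeaultLaplacian_of_isManifold_complex_of_t2Space g o) hg hm
    (existsUnique_isHarmonicForm_mk_eq_of_compact_of_dolbeault g o hg ?_ ?_ k m) ho
  · intro _ _ hJ p q m' h ho'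
    exact hC g hJ o p q h ho'
  · intro _ _ hJ p q m' h ho'
    exact hR g hJ o p q h ho'

end Assembly

end Literature.AlgebraicGeometry.Motives
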